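import Mathlib
import HarnessLib

/-!
# Route `BackwardLiouvilleRigidity` (rev 7), crux `BackwardStabilityAdm` (stmt-QuantumFields-23331),
LINE «backward-lyapunov» — registered stub `stub_gronwall` (M)

The discrete backward Grönwall chain: the arithmetic core of the proved chain lemma
`Summit.QuantumFields.YangMills.Theorems.backwardLiouvilleRigidity_backwardChainLemmaAdm_proof` (✓p660990,
`Theorems/BackwardLiouvilleRigidityBackwardChainLemmaAdm.lean`, the `claim` induction) with the presentation size
`a_i + θ w_i` replaced by a free nonnegative functional `Φ i` and the top smallness `θ ω_J` by a free `v ≥ 0`.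

Statement (registered signature of the skeleton
`Summits/QuantumFields/YangMills/Cruxes/FluctuationComparisonRegPrIntL/Lines/backward_stability_adm.lean`, ym-r3-idea-1 g13):
if `Φ ≥ 0`, `Φ J ≤ v`, and `Φ i ≤ (1 + ε i + C Φ (i+1)) Φ (i+1) + δ i` for `j₁ ≤ i < J` whenever `Φ (i+1) ≤ w₀`
(`ε, δ ≥ 0` summable, tails `D i := ∑' k, δ (k+i)` summable in `i`), then at every `j₁ ≤ j ≤ J` satisfying the two
smallness conditions `exp (∑' ε + 1) (v + D j) ≤ w₀` and `C · exp (∑' ε + 1) (J v + ∑' i, D (i+j)) ≤ 1` one has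
`Φ j ≤ exp (∑' ε + 1) (v + D j)`.

Proof: backward induction on `n` with `i + n = J` of the sharper bound
`Φ i ≤ exp (∑_{Ico i J} ε + C e^{∑'ε+1} ((J−i) v + ∑_{n ∈ Ico i J} D (n+1))) · (v + D i)`, using
`1 + x ≤ exp x`, `D i = δ i + D (i+1)` and antitonicity of `D`; the exponent is `≤ ∑' ε + 1` by the quadratic
smallness condition, and the side condition `Φ (i+1) ≤ w₀` follows from `D (i+1) ≤ D j` and the first condition.

Free-hands width seat `ym-line-sfw-p2-w2` (cell ym-idea-1), `--supports stmt-QuantumFields-23331`.  Pure real analysis;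
no summit, rung, organ or crux is proved by this file; `YM3TorusSU2` and the Yang–Mills mass gap are NOT proved.
-/

set_option autoImplicit false

namespace Summit.QuantumFields.YangMills.Theorems.BackwardLiouvilleRigidity.BackwardLyapunov

open scoped BigOperators Topology

/-- **`stub_gronwall`** (registered stub of LINE «backward-lyapunov» on crux stmt-QuantumFields-23331
`BackwardStabilityAdm`, signature verbatim): the discrete backward Grönwall chain.  For a nonnegative sequence `Φ`
with `Φ J ≤ v` obeying the one-step inequality `Φ i ≤ (1 + ε i + C Φ (i+1)) Φ (i+1) + δ i` (`j₁ ≤ i < J`, while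
`Φ (i+1) ≤ w₀`), with `ε, δ ≥ 0` summable and summable tails `∑' k, δ (k+i)`, the bound
`Φ j ≤ exp (∑' ε + 1) · (v + ∑' k, δ (k+j))` holds at every `j₁ ≤ j ≤ J` where the two smallness conditions hold.
Port of the `claim` induction of ✓p660990 with `V_i := Φ i`, `v := θ ω_J`. [folklore] -/
theorem stub_gronwall : ∀ (C w₀ : ℝ) (ε δ Φ : ℕ → ℝ) (v : ℝ) (j₁ J : ℕ), 0 ≤ C → (∀ j, 0 ≤ ε j ∧ 0 ≤ δ j) → Summable ε → Summable δ → Summable (fun i => ∑' k, δ (k + i)) → (∀ j, 0 ≤ Φ j) → 0 ≤ v → Φ J ≤ v → (∀ j : ℕ, j₁ ≤ j → j < J → Φ (j + 1) ≤ w₀ → Φ j ≤ (1 + ε j + C * Φ (j + 1)) * Φ (j + 1) + δ j) → ∀ j : ℕ, j₁ ≤ j → j ≤ J → Real.exp (∑' k, ε k + 1) * (v + (∑' k, δ (k + j))) ≤ w₀ → C * (Real.exp (∑' k, ε k + 1) * ((J : ℝ) * v + (∑' i, ∑' k, δ (k + (i + j))))) ≤ 1 → Φ j ≤ Real.exp (∑'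 k, ε k + 1) * (v + (∑' k, δ (k + j))) := by
  intro C w₀ ε δ Φ v j₁ J hC hεδ hεs hδs hDs hΦnn hv0 hΦtop hstep j hj hJj hsmall hquad
  have hε0 : ∀ k, 0 ≤ ε k := fun k => (hεδ k).1
  have hδ0 : ∀ k, 0 ≤ δ k := fun k => (hεδ k).2
  have hG : 0 < Real.exp (∑' k, ε k + 1) := Real.exp_pos _
  have hDnn : ∀ i : ℕ, 0 ≤ ∑' k, δ (k + i) := fun i => tsum_nonneg fun k => hδ0 _
  -- tail recursion `D i = δ i + D (i+1)` and antitonicity of the tails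
  have hDsucc : ∀ i : ℕ, ∑' k, δ (k + i) = δ i + ∑' k, δ (k + (i + 1)) := by
    intro i
    have hs : Summable (fun k => δ (k + i)) := (summable_nat_add_iff (f := δ) i).mpr hδs
    rw [hs.tsum_eq_zero_add]
    simp only [zero_add]
    congr 1
    exact tsum_congr fun k => by rw [show k + 1 + i = k + (i + 1) by omega]
  have hDanti : ∀ i : ℕ, ∑' k, δ (k + (i + 1)) ≤ ∑' k, δ (k + i) := fun i => by
    rw [hDsucc i]; linarith [hδ0 i]
  have hDmono : Antitone (fun i : ℕ => ∑' k, δ (k + i)) := antitone_nat_of_succ_le hDanti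
  -- the finite sums of tails along the stretch are dominated by the double tail sum at `j`
  have hsumD : ∀ i : ℕ, j ≤ i →
      ∑ n ∈ Finset.Ico i J, (∑' k, δ (k + (n + 1))) ≤ (∑' i, ∑' k, δ (k + (i + j))) := by
    intro i hji
    have hDs' : Summable (fun n => ∑' k, δ (k + (n + j))) :=
      (summable_nat_add_iff (f := fun i => ∑' k, δ (k + i)) j).mpr hDs
    calc ∑ n ∈ Finset.Ico i J, (∑' k, δ (k + (n + 1)))
        ≤ ∑ k ∈ Finset.Ico i J, ∑' m, δ (m + k) := Finset.sum_le_sum fun k _ => hDanti k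
      _ ≤ ∑ k ∈ Finset.Ico j J, ∑' m, δ (m + k) :=
          Finset.sum_le_sum_of_subset_of_nonneg (Finset.Ico_subset_Ico hji le_rfl) fun k _ _ => hDnn k
      _ = ∑ n ∈ Finset.range (J - j), ∑' m, δ (m + (j + n)) := Finset.sum_Ico_eq_sum_range _ _ _
      _ = ∑ n ∈ Finset.range (J - j), ∑' m, δ (m + (n + j)) := by
          refine Finset.sum_congr rfl fun n _ => ?_
          rw [Nat.add_comm j n]
      _ ≤ (∑' i, ∑' k, δ (k + (i + j))) := hDs'.sum_le_tsum _ fun n _ => hDnn _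
  have hsumε : ∀ i : ℕ, ∑ k ∈ Finset.Ico i J, ε k ≤ ∑' k, ε k := fun i => hεs.sum_le_tsum _ fun k _ => hε0 k
  -- the accumulated exponent along the stretch is bounded by `∑' ε + 1` (quadratic smallness)
  have hEXPO : ∀ i : ℕ, j ≤ i →
      (∑ k ∈ Finset.Ico i J, ε k + C * (Real.exp (∑' k, ε k + 1) *
        (((J - i : ℕ) : ℝ) * v + ∑ n ∈ Finset.Ico i J, (∑' k, δ (k + (n + 1)))))) ≤ ∑' k, ε k + 1 := by
    intro i hji
    have h1 := hsumε i
    have hJi : ((J - i : ℕ) : ℝ) ≤ (J : ℝ) := by exact_mod_cast Nat.sub_le J i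
    have h3 : ((J - i : ℕ) : ℝ) * v + ∑ n ∈ Finset.Ico i J, (∑' k, δ (k + (n + 1)))
        ≤ (J : ℝ) * v + (∑' i, ∑' k, δ (k + (i + j))) :=
      add_le_add (mul_le_mul_of_nonneg_right hJi hv0) (hsumD i hji)
    have h2 : C * (Real.exp (∑' k, ε k + 1) *
        (((J - i : ℕ) : ℝ) * v + ∑ n ∈ Finset.Ico i J, (∑' k, δ (k + (n + 1))))) ≤ 1 :=
      le_trans (mul_le_mul_of_nonneg_left (mul_le_mul_of_nonneg_left h3 hG.le) hC) hquad
    linarith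
  have hEXPOnn : ∀ i : ℕ, 0 ≤ (∑ k ∈ Finset.Ico i J, ε k + C * (Real.exp (∑' k, ε k + 1) *
      (((J - i : ℕ) : ℝ) * v + ∑ n ∈ Finset.Ico i J, (∑' k, δ (k + (n + 1)))))) := fun i =>
    add_nonneg (Finset.sum_nonneg fun k _ => hε0 k)
      (mul_nonneg hC (mul_nonneg hG.le (add_nonneg (mul_nonneg (Nat.cast_nonneg _) hv0)
        (Finset.sum_nonneg fun n _ => hDnn (n + 1)))))
  -- backward induction down the stretch with the sharper, position-dependent exponent
  have claim : ∀ n : ℕ, ∀ i : ℕ, i + n = J → j ≤ i →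
      Φ i ≤ Real.exp (∑ k ∈ Finset.Ico i J, ε k + C * (Real.exp (∑' k, ε k + 1) *
        (((J - i : ℕ) : ℝ) * v + ∑ n ∈ Finset.Ico i J, (∑' k, δ (k + (n + 1)))))) * (v + (∑' k, δ (k + i))) := by
    intro n
    induction n with
    | zero =>
      intro i hi hji
      have hiJ : J = i := by omega
      subst hiJ
      calc Φ J ≤ v := hΦtop
        _ = 1 * v := (one_mul _).symm
        _ ≤ Real.exp (∑ k ∈ Finset.Ico J J, ε k + C * (Real.exp (∑' k, ε k + 1) *
              (((J - J : ℕ) : ℝ) * v + ∑ n ∈ Finset.Ico J J, (∑' k, δ (k + (n + 1)))))) *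
              (v + (∑' k, δ (k + J))) :=
            mul_le_mul (Real.one_le_exp (hEXPOnn J)) (by linarith [hDnn J]) hv0 (Real.exp_pos _).le
    | succ n ih =>
      intro i hi hji
      have hiJ : i < J := by omega
      have hj1i : j₁ ≤ i := le_trans hj hji
      have hVb := ih (i + 1) (by omega) (by omega)
      have hVnn : 0 ≤ Φ (i + 1) := hΦnn _
      have hx1 : 0 ≤ v + (∑' k, δ (k + (i + 1))) := add_nonneg hv0 (hDnn _)
      have hB1 : Φ (i + 1) ≤ Real.exp (∑' k, ε k + 1) * (v + (∑' k, δ (k + (i + 1)))) :=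
        hVb.trans (mul_le_mul_of_nonneg_right (Real.exp_le_exp.mpr (hEXPO (i + 1) (by omega))) hx1)
      have hside : Φ (i + 1) ≤ w₀ := by
        have hD' : (∑' k, δ (k + (i + 1))) ≤ (∑' k, δ (k + j)) := hDmono (show j ≤ i + 1 by omega)
        have : Real.exp (∑' k, ε k + 1) * (v + (∑' k, δ (k + (i + 1))))
            ≤ Real.exp (∑' k, ε k + 1) * (v + (∑' k, δ (k + j))) :=
          mul_le_mul_of_nonneg_left (by linarith) hG.le
        exact hB1.trans (this.trans hsmall)
      have hV' := hstep i hj1i hiJ hside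
      have hfac : 1 + ε i + C * Φ (i + 1)
          ≤ Real.exp (ε i + C * (Real.exp (∑' k, ε k + 1) * (v + (∑' k, δ (k + (i + 1)))))) := by
        have h1 : C * Φ (i + 1) ≤ C * (Real.exp (∑' k, ε k + 1) * (v + (∑' k, δ (k + (i + 1))))) :=
          mul_le_mul_of_nonneg_left hB1 hC
        have h2 := Real.add_one_le_exp (ε i + C * (Real.exp (∑' k, ε k + 1) * (v + (∑' k, δ (k + (i + 1))))))
        linarith
      have hfacnn : 0 ≤ 1 + ε i + C * Φ (i + 1) := by
        have := mul_nonneg hC hVnn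
        linarith [hε0 i]
      have hprod : 1 ≤ Real.exp (ε i + C * (Real.exp (∑' k, ε k + 1) * (v + (∑' k, δ (k + (i + 1)))))) *
          Real.exp (∑ k ∈ Finset.Ico (i + 1) J, ε k + C * (Real.exp (∑' k, ε k + 1) *
            (((J - (i + 1) : ℕ) : ℝ) * v + ∑ n ∈ Finset.Ico (i + 1) J, (∑' k, δ (k + (n + 1)))))) := by
        rw [← Real.exp_add]
        exact Real.one_le_exp (add_nonneg (add_nonneg (hε0 i) (mul_nonneg hC (mul_nonneg hG.le hx1)))
          (hEXPOnn (i + 1)))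
      have hIcoε : ∑ k ∈ Finset.Ico i J, ε k = ε i + ∑ k ∈ Finset.Ico (i + 1) J, ε k :=
        Finset.sum_eq_sum_Ico_succ_bot hiJ _
      have hIcoD : ∑ n ∈ Finset.Ico i J, (∑' k, δ (k + (n + 1)))
          = (∑' k, δ (k + (i + 1))) + ∑ n ∈ Finset.Ico (i + 1) J, (∑' k, δ (k + (n + 1))) :=
        Finset.sum_eq_sum_Ico_succ_bot hiJ (fun n => (∑' k, δ (k + (n + 1))))
      have hsub : ((J - i : ℕ) : ℝ) = ((J - (i + 1) : ℕ) : ℝ) + 1 := by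
        have : (J - i : ℕ) = (J - (i + 1)) + 1 := by omega
        rw [this]; push_cast; ring
      have hE : (ε i + C * (Real.exp (∑' k, ε k + 1) * (v + (∑' k, δ (k + (i + 1)))))) +
          (∑ k ∈ Finset.Ico (i + 1) J, ε k + C * (Real.exp (∑' k, ε k + 1) *
            (((J - (i + 1) : ℕ) : ℝ) * v + ∑ n ∈ Finset.Ico (i + 1) J, (∑' k, δ (k + (n + 1))))))
          = (∑ k ∈ Finset.Ico i J, ε k + C * (Real.exp (∑' k, ε k + 1) *
            (((J - i : ℕ) : ℝ) * v + ∑ n ∈ Finset.Ico i J, (∑' k, δ (k + (n + 1)))))) := by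
        rw [hIcoε, hIcoD, hsub]; ring
      -- abbreviations for the two exponential factors
      set A := Real.exp (ε i + C * (Real.exp (∑' k, ε k + 1) * (v + (∑' k, δ (k + (i + 1)))))) with hA
      set B := Real.exp (∑ k ∈ Finset.Ico (i + 1) J, ε k + C * (Real.exp (∑' k, ε k + 1) *
            (((J - (i + 1) : ℕ) : ℝ) * v + ∑ n ∈ Finset.Ico (i + 1) J, (∑' k, δ (k + (n + 1)))))) with hB
      calc Φ i ≤ (1 + ε i + C * Φ (i + 1)) * Φ (i + 1) + δ i := hV'
        _ ≤ A * (B * (v + (∑' k, δ (k + (i + 1))))) + δ i := by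
            have := mul_le_mul hfac hVb hVnn (Real.exp_pos _).le
            linarith
        _ ≤ A * B * (v + (∑' k, δ (k + (i + 1))) + δ i) := by
            have hδ' : δ i ≤ A * B * δ i := le_mul_of_one_le_left (hδ0 i) hprod
            have hring : A * (B * (v + (∑' k, δ (k + (i + 1))))) + δ i
                = A * B * (v + (∑' k, δ (k + (i + 1))) + δ i) - (A * B * δ i - δ i) := by ring
            rw [hring]; linarith [hδ']
        _ = Real.exp (∑ k ∈ Finset.Ico i J, ε k + C * (Real.exp (∑' k, ε k + 1) *
              (((J - i : ℕ) : ℝ) * v + ∑ n ∈ Finset.Ico i J, (∑' k, δ (k + (n + 1)))))) *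
              (v + (∑' k, δ (k + i))) := by
            rw [hA, hB, ← Real.exp_add, hE, hDsucc i]; ring
  have hfin := claim (J - j) j (by omega) le_rfl
  exact hfin.trans (mul_le_mul_of_nonneg_right (Real.exp_le_exp.mpr (hEXPO j le_rfl))
    (add_nonneg hv0 (hDnn j)))

end Summit.QuantumFields.YangMills.Theorems.BackwardLiouvilleRigidity.BackwardLyapunov
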